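import Summits.Ventures.CertifiedManyBodySolver.Observables.PhaseSeparationExclusionBoxZeeman
import Literature.MathematicalPhysics.QuantumLattice.HubbardTTPrimePhaseCoexistenceExclusionLayered
import HarnessLib

/-!
# Ventures/CertifiedManyBodySolver — Observables/PhaseSeparationExclusionBoxLayered.lean

HONEST FRAMING: the INTERLAYER (c-axis) edition of `Observables/PhaseSeparationExclusionBox{,ThermalHotAnchor,Zeeman}.lean` — EXCLUSION of
MACROSCOPIC PHASE COEXISTENCE (a phase of density `≤ n₁` with a phase of density `≥ n₂`) on a `(t′, U)` CELL of a material box FOR THE 3D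
LAYERED `t–t′` HUBBARD CRYSTAL `layeredHubbardTTPrime t s U w tz` (any stacking vectors `w_b` with `(w_b)₀ ≠ 0`, hoppings `tz_b`), among its
ground states (`T = 0`) and its canonical equilibrium states (`T > 0`, every `β ≥ β₀`), for EVERY stacking whose kinematic interlayer cost
`(4/π)·Σ_b|tz_b|` is `≤ k` — from the SAME 2D inputs as the parents (cap affine in `U`, two `n₂`-column laws, a dilute floor, cell-uniform
2D hot anchors); the only change is the constant `k` subtracted from every margin (law
`Literature/…/HubbardTTPrimePhaseCoexistenceExclusionLayered.lean`: the interlayer hopping lowers the 2D floors by at most `(4/π)Σ|tz|`,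
density-independently, and keeps the caps). CONTROL class; conditional on the rows and anchors the instances name; the cost is the CRUDE
linear kinematic one (true interlayer energies are `O(t_z²/t)`), so the reach in `Σ|tz|` is a floor, not an estimate; nothing about stripes,
which phase is realised, or superconductivity; no number of record. Zero compute, no definition, no claim node, no `sorry`.

Cell `pub/hubbard-downfold` (MO-S1 ↔ S2 seam «box ↦ one word»; D-0096 (iii) interlayer coupling × competing orders), seat
`hubbard-downfold-unc-2` (`prover-hubbard-downfold-unc-2-g21-0`). Contents (algebra = `hotAnchor_chord_slack` of the Zeeman edition):
* `psL_not_layeredGroundState_mix_on_cell_of_columns` / `…_above_column` — `T = 0` COLUMN FORMS for the layered crystal;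
* `psLT_not_layeredEquilibrium_mix_on_cell_of_columns_hotAnchor` / `…_above_column_hotAnchor` — `T > 0` COLUMN × THRESHOLD FORMS.
Instances: `Downfold/BoxesLa214V115M2cPhaseSeparationLayered.lean`, `Observables/PhaseSeparationExclusionU8Layered.lean`.
References: R. B. Israel, *Convexity in the Theory of Lattice Gases* (1979) Thm I.2.4 [Israel1979]; O. Bratteli, A. Kishimoto, D. W.
Robinson, CMP 64 (1978) 41 [BratteliKishimotoRobinson1978]; E. Pavarini et al., PRL 87 (2001) 047003 [PavariniEtAl2001]; D. Poulin,
M. B. Hastings, PRL 106 (2011) 080403 [PoulinHastings2011]; V. J. Emery, S. A. Kivelson, H. Q. Lin, PRL 64 (1990) 475 [EmeryKivelsonLin1990].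
-/

noncomputable section

namespace Summit.Ventures.CertifiedManyBodySolver.Observables

open Literature.MathematicalPhysics.QuantumLattice Literature.MathematicalPhysics.QuantumLattice.ThermodynamicLimit
open Literature.MathematicalPhysics.QuantumLattice.InfVolFermionState Set Filter
open Literature.Probability.LatticeModels HubbardWave0
open scoped BigOperators

/-! ## §1 `T = 0`: ground states of the layered crystal on a cell -/

/-- **LAYERED-CRYSTAL PS EXCLUSION ON A CELL, `T = 0`, COLUMN FORM.** Cell `[s₁, s₂] × [U₁, U₂]` (`0 ≤ U₁ < U₂`); densities `0 ≤ n₁ < n₂ < 2`,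
weights `a, b ≥ 0`, `a + b = 1`; 2D DATA as in `ps_not_groundState_mix_on_cell_of_columns` (cap `c₀ + c₁U`, column laws `L_i(s) ≤ e(t,s,U_i,n₂)`,
dilute floor `F₁(s)`), a stacking with `(4/π)Σ_b|tz_b| ≤ k`, and POSITIVE COLUMN MARGINS AFTER THE INTERLAYER COST,
`c₀ + c₁U_i + k < aF₁(s) + bL_i(s)`. THEN at every `(s, U)` of the cell no mixture `λω₁ + (1−λ)ω₂` (`0 < λ < 1`) of translation-invariant states
on `ℤ³` with `0 < ρ(ω₁) ≤ n₁`, `n₂ ≤ ρ(ω₂) < 2` is a ground state of the layered crystal `layeredHubbardTTPrime t s U w tz` at its filling.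
[cite: Israel1979, Thm. I.2.4] [cite: BratteliKishimotoRobinson1978, Thm. 2 (condition 2)] -/
theorem psL_not_layeredGroundState_mix_on_cell_of_columns (t : ℝ) {κ : Type*} [Fintype κ] {w : κ → Site 3}
    (hw : ∀ b, w b 0 ≠ 0) (tz : κ → ℝ) {R' : ℝ} (hR' : 1 ≤ R') (hwR' : ∀ b, w b ∈ thicken ({0} : Finset (Site 3)) R')
    {s₁ s₂ U₁ U₂ n₁ n₂ a b c₀ c₁ k : ℝ} (hU₁ : 0 ≤ U₁) (h12 : U₁ < U₂) (hn₁ : 0 ≤ n₁) (hn : n₁ < n₂) (hn₂ : n₂ < 2)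
    (ha : 0 ≤ a) (hb : 0 ≤ b) (hab : a + b = 1) {L₁ L₂ F₁ : ℝ → ℝ}
    (hC : ∀ s ∈ Icc s₁ s₂, ∀ U ∈ Icc U₁ U₂, energyDensityTT' t s U (a * n₁ + b * n₂) ≤ c₀ + c₁ * U)
    (hL₁ : ∀ s ∈ Icc s₁ s₂, L₁ s ≤ energyDensityTT' t s U₁ n₂) (hL₂ : ∀ s ∈ Icc s₁ s₂, L₂ s ≤ energyDensityTT' t s U₂ n₂)
    (hF₁ : ∀ s ∈ Icc s₁ s₂, ∀ U ∈ Icc U₁ U₂, F₁ s ≤ energyDensityTT' t s U n₁)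
    (hk : 4 / Real.pi * ∑ b, |tz b| ≤ k)
    (hm₁ : ∀ s ∈ Icc s₁ s₂, c₀ + c₁ * U₁ + k < a * F₁ s + b * L₁ s)
    (hm₂ : ∀ s ∈ Icc s₁ s₂, c₀ + c₁ * U₂ + k < a * F₁ s + b * L₂ s)
    {s : ℝ} (hs : s ∈ Icc s₁ s₂) {U : ℝ} (hU : U ∈ Icc U₁ U₂)
    {ω₁ ω₂ : InfVolFermionState 3} (h₁ : ω₁.IsTranslationInvariant) (h₂ : ω₂.IsTranslationInvariant)
    (hρ₁ : 0 < ω₁.density) (hρ₁' : ω₁.density ≤ n₁) (hρ₂ : n₂ ≤ ω₂.density) (hρ₂' : ω₂.density < 2)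
    {lam : ℝ} (hl0 : 0 < lam) (hl1 : lam < 1) :
    (layeredHubbardTTPrime t s U w tz).tiGroundEnergyDensityAt R' (mix lam hl0.le hl1.le ω₁ ω₂).density <
      (mix lam hl0.le hl1.le ω₁ ω₂).meanEnergy (layeredHubbardTTPrime t s U w tz) R' := by
  have hn2' : 0 ≤ n₂ := hn₁.trans hn.le
  have hF₂ := floor_on_cell_of_columnLaws t hn2' hn₂ hU₁ h12 hL₁ hL₂ s hs U hU
  refine h₁.layeredGroundEnergy_lt_meanEnergy_mix_of_cap_lt_floors_of_cost_le t s (hU₁.trans hU.1) hw tz hR' hwR' h₂ hρ₁ hρ₂' hρ₁'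
    hn hρ₂ ha hb hab (hC s hs U hU) (hF₁ s hs U hU) hF₂ hk ?_ hl0 hl1
  have hpos := uchord_pos_of_ends h12 hU (sub_pos.2 (hm₁ s hs)) (sub_pos.2 (hm₂ s hs))
  have hd : (U₂ - U₁) ≠ 0 := (sub_pos.2 h12).ne'
  have hid : a * F₁ s + b * (((U₂ - U) * L₁ s + (U - U₁) * L₂ s) / (U₂ - U₁)) - (c₀ + c₁ * U + k) =
      ((U₂ - U) * (a * F₁ s + b * L₁ s - (c₀ + c₁ * U₁ + k)) +
        (U - U₁) * (a * F₁ s + b * L₂ s - (c₀ + c₁ * U₂ + k))) / (U₂ - U₁) := by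
    field_simp
    ring
  have h := hid ▸ hpos
  linarith

/-- **LAYERED-CRYSTAL PS EXCLUSION ABOVE A COLUMN, `T = 0`.** For `U ∈ [U₂, U₃]` (`U₂ ≥ 0`): cap `c₀ + c₁U` with `c₁ ≥ 0`, ONE column law
`L(s) ≤ e(t,s,U₂,n₂)`, dilute floor `F₁(s)`, stacking with `(4/π)Σ|tz| ≤ k`, and the FAR-END margin after the cost,
`c₀ + c₁U₃ + k < aF₁(s) + bL(s)`: the mixtures are excluded among ground states of the layered crystal on the whole cell.
[cite: Israel1979, Thm. I.2.4] [cite: BratteliKishimotoRobinson1978, Thm. 2 (condition 2)] -/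
theorem psL_not_layeredGroundState_mix_above_column (t : ℝ) {κ : Type*} [Fintype κ] {w : κ → Site 3}
    (hw : ∀ b, w b 0 ≠ 0) (tz : κ → ℝ) {R' : ℝ} (hR' : 1 ≤ R') (hwR' : ∀ b, w b ∈ thicken ({0} : Finset (Site 3)) R')
    {s₁ s₂ U₂ U₃ n₁ n₂ a b c₀ c₁ k : ℝ} (hU₂ : 0 ≤ U₂) (hc₁ : 0 ≤ c₁) (hn₁ : 0 ≤ n₁) (hn : n₁ < n₂) (hn₂ : n₂ < 2)
    (ha : 0 ≤ a) (hb : 0 ≤ b) (hab : a + b = 1) {L F₁ : ℝ → ℝ}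
    (hC : ∀ s ∈ Icc s₁ s₂, ∀ U ∈ Icc U₂ U₃, energyDensityTT' t s U (a * n₁ + b * n₂) ≤ c₀ + c₁ * U)
    (hL : ∀ s ∈ Icc s₁ s₂, L s ≤ energyDensityTT' t s U₂ n₂)
    (hF₁ : ∀ s ∈ Icc s₁ s₂, ∀ U ∈ Icc U₂ U₃, F₁ s ≤ energyDensityTT' t s U n₁)
    (hk : 4 / Real.pi * ∑ b, |tz b| ≤ k)
    (hm : ∀ s ∈ Icc s₁ s₂, c₀ + c₁ * U₃ + k < a * F₁ s + b * L s)
    {s : ℝ} (hs : s ∈ Icc s₁ s₂) {U : ℝ} (hU : U ∈ Icc U₂ U₃)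
    {ω₁ ω₂ : InfVolFermionState 3} (h₁ : ω₁.IsTranslationInvariant) (h₂ : ω₂.IsTranslationInvariant)
    (hρ₁ : 0 < ω₁.density) (hρ₁' : ω₁.density ≤ n₁) (hρ₂ : n₂ ≤ ω₂.density) (hρ₂' : ω₂.density < 2)
    {lam : ℝ} (hl0 : 0 < lam) (hl1 : lam < 1) :
    (layeredHubbardTTPrime t s U w tz).tiGroundEnergyDensityAt R' (mix lam hl0.le hl1.le ω₁ ω₂).density <
      (mix lam hl0.le hl1.le ω₁ ω₂).meanEnergy (layeredHubbardTTPrime t s U w tz) R' := by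
  have hn2' : 0 ≤ n₂ := hn₁.trans hn.le
  have hF₂ := floor_above_column_of_law t hn2' hn₂ hU₂ hL s hs U hU.1
  refine h₁.layeredGroundEnergy_lt_meanEnergy_mix_of_cap_lt_floors_of_cost_le t s (hU₂.trans hU.1) hw tz hR' hwR' h₂ hρ₁ hρ₂' hρ₁'
    hn hρ₂ ha hb hab (hC s hs U hU) (hF₁ s hs U hU) hF₂ hk ?_ hl0 hl1
  have k' := mul_le_mul_of_nonneg_left hU.2 hc₁
  have := hm s hs
  linarith

/-! ## §2 `T > 0`: canonical equilibrium states of the layered crystal on a cell -/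

/-- **LAYERED-CRYSTAL THERMAL PS EXCLUSION ON A CELL, COLUMN × THRESHOLD FORM.** Cell `[s₁, s₂] × [U₁, U₂]` (`0 ≤ U₁ < U₂`),
`0 ≤ n₁ < n₂ < 2`, weights `a + b = 1`; 2D data as in `psT_not_thermal_mix_on_cell_of_columns_hotAnchor` (cap `c₀ + c₁U`, column laws
`L₁, L₂`, dilute floor `F₁`, cell-uniform 2D anchors `p(β_{h,i}; n_i) ≤ π_i`, `0 ≤ β_{h,i} ≤ β₀ ≤ β`), a stacking with `(4/π)Σ_b|tz_b| ≤ k` and,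
on BOTH columns, the `T = 0` margin AFTER the cost `k` is `≥ 0` and the ANCHORED INEQUALITY holds at `β₀` with that margin. THEN at every
`(s, U)` of the cell no mixture `λω₁ + (1−λ)ω₂` (`0 < λ < 1`) of translation-invariant states on `ℤ³` with `0 < ρ(ω₁) ≤ n₁`, `n₂ ≤ ρ(ω₂) < 2`
is a canonical equilibrium state of `layeredHubbardTTPrime t s U w tz` at `β`: `s̄(mix) − βe_{Φ₃}(mix) < P₃(β; t,s,U; ρ(mix))`.
[cite: Israel1979, Thm. I.2.4] [cite: PoulinHastings2011, eqs. (3)–(8)] [cite: BratteliKishimotoRobinson1978, Thm. 2 (condition 2)] -/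
theorem psLT_not_layeredEquilibrium_mix_on_cell_of_columns_hotAnchor (t : ℝ) {κ : Type*} [Fintype κ] {w : κ → Site 3}
    (hw : ∀ b, w b 0 ≠ 0) (tz : κ → ℝ) {R' : ℝ} (hR' : 1 ≤ R') (hwR' : ∀ b, w b ∈ thicken ({0} : Finset (Site 3)) R')
    {s₁ s₂ U₁ U₂ n₁ n₂ a b c₀ c₁ β β₀ βh₁ βh₂ π₁ π₂ k : ℝ}
    (hU₁ : 0 ≤ U₁) (h12 : U₁ < U₂) (hn₁ : 0 ≤ n₁) (hn : n₁ < n₂) (hn₂ : n₂ < 2) (ha : 0 ≤ a) (hb : 0 ≤ b)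
    (hab : a + b = 1) (hβh₁ : 0 ≤ βh₁) (hβh₂ : 0 ≤ βh₂) (h0₁ : βh₁ ≤ β₀) (h0₂ : βh₂ ≤ β₀) (hβ₀ : β₀ ≤ β)
    (hβ₀pos : 0 < β₀) {L₁ L₂ F₁ : ℝ → ℝ}
    (hC : ∀ s ∈ Icc s₁ s₂, ∀ U ∈ Icc U₁ U₂, energyDensityTT' t s U (a * n₁ + b * n₂) ≤ c₀ + c₁ * U)
    (hL₁ : ∀ s ∈ Icc s₁ s₂, L₁ s ≤ energyDensityTT' t s U₁ n₂) (hL₂ : ∀ s ∈ Icc s₁ s₂, L₂ s ≤ energyDensityTT' t s U₂ n₂)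
    (hF₁ : ∀ s ∈ Icc s₁ s₂, ∀ U ∈ Icc U₁ U₂, F₁ s ≤ energyDensityTT' t s U n₁)
    (hπ₁ : ∀ s ∈ Icc s₁ s₂, ∀ U ∈ Icc U₁ U₂, pressureTT' βh₁ t s U n₁ ≤ π₁)
    (hπ₂ : ∀ s ∈ Icc s₁ s₂, ∀ U ∈ Icc U₁ U₂, pressureTT' βh₂ t s U n₂ ≤ π₂)
    (hk : 4 / Real.pi * ∑ b, |tz b| ≤ k)
    (hm₁ : ∀ s ∈ Icc s₁ s₂, 0 ≤ a * F₁ s + b * L₁ s - (c₀ + c₁ * U₁) - k)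
    (hm₂ : ∀ s ∈ Icc s₁ s₂, 0 ≤ a * F₁ s + b * L₂ s - (c₀ + c₁ * U₂) - k)
    (hg₁ : ∀ s ∈ Icc s₁ s₂, a * π₁ + b * π₂ + βh₁ * (a * F₁ s) + βh₂ * (b * L₁ s) <
      β₀ * (a * F₁ s + b * L₁ s - (c₀ + c₁ * U₁) - k))
    (hg₂ : ∀ s ∈ Icc s₁ s₂, a * π₁ + b * π₂ + βh₁ * (a * F₁ s) + βh₂ * (b * L₂ s) <
      β₀ * (a * F₁ s + b * L₂ s - (c₀ + c₁ * U₂) - k))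
    {s : ℝ} (hs : s ∈ Icc s₁ s₂) {U : ℝ} (hU : U ∈ Icc U₁ U₂)
    {ω₁ ω₂ : InfVolFermionState 3} (h₁ : ω₁.IsTranslationInvariant) (h₂ : ω₂.IsTranslationInvariant)
    (hρ₁ : 0 < ω₁.density) (hρ₁' : ω₁.density ≤ n₁) (hρ₂ : n₂ ≤ ω₂.density) (hρ₂' : ω₂.density < 2)
    {lam : ℝ} (hl0 : 0 < lam) (hl1 : lam < 1) :
    (mix lam hl0.le hl1.le ω₁ ω₂).entropyDensitySup -
        β * (mix lam hl0.le hl1.le ω₁ ω₂).meanEnergy (layeredHubbardTTPrime t s U w tz) R' <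
      (layeredHubbardTTPrime t s U w tz).varPressureAt β R' (mix lam hl0.le hl1.le ω₁ ω₂).density := by
  have hn2' : 0 ≤ n₂ := hn₁.trans hn.le
  have hβpos : 0 < β := hβ₀pos.trans_le hβ₀
  have hF₂ := floor_on_cell_of_columnLaws t hn2' hn₂ hU₁ h12 hL₁ hL₂ s hs U hU
  obtain ⟨hMnn, hM₀⟩ := hotAnchor_chord_slack (βh₁ := βh₁) (βh₂ := βh₂) (π₁ := π₁) (π₂ := π₂) h12 hU (hm₁ s hs) (hm₂ s hs)
    (hg₁ s hs) (hg₂ s hs)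
  exact h₁.sub_mul_layered_lt_varPressureAt_mix_of_hotAnchors_of_threshold_of_cost_le t s (hU₁.trans hU.1) hβpos hw tz hR' hwR'
    h₂ hρ₁ hρ₂' hρ₁' hn hρ₂ ha hb hab (hC s hs U hU) (hF₁ s hs U hU) hF₂ hβh₁ hβh₂ h0₁ h0₂ hβ₀ (hπ₁ s hs U hU) (hπ₂ s hs U hU)
    hk hMnn hM₀ hl0 hl1

/-- **LAYERED-CRYSTAL THERMAL PS EXCLUSION ABOVE A COLUMN (threshold form).** For `U ∈ [U₂, U₃]` (`U₂ ≥ 0`): cap `c₀ + c₁U` with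
`c₁ ≥ 0`, ONE column law `L(s) ≤ e(t,s,U₂,n₂)`, dilute floor `F₁(s)`, cell-uniform anchors (`0 ≤ β_{h,i} ≤ β₀ ≤ β`), a stacking with
`(4/π)Σ|tz| ≤ k`, and at the FAR END `U₃` the `T = 0` margin after the cost `k` is `≥ 0` and the anchored inequality holds at `β₀`: the
exclusion among canonical equilibrium states of the layered crystal holds on the whole cell at `β`. [cite: Israel1979, Thm. I.2.4]
[cite: PoulinHastings2011, eqs. (3)–(8)] -/
theorem psLT_not_layeredEquilibrium_mix_above_column_hotAnchor (t : ℝ) {κ : Type*} [Fintype κ] {w : κ → Site 3}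
    (hw : ∀ b, w b 0 ≠ 0) (tz : κ → ℝ) {R' : ℝ} (hR' : 1 ≤ R') (hwR' : ∀ b, w b ∈ thicken ({0} : Finset (Site 3)) R')
    {s₁ s₂ U₂ U₃ n₁ n₂ a b c₀ c₁ β β₀ βh₁ βh₂ π₁ π₂ k : ℝ}
    (hU₂ : 0 ≤ U₂) (hc₁ : 0 ≤ c₁) (hn₁ : 0 ≤ n₁) (hn : n₁ < n₂) (hn₂ : n₂ < 2) (ha : 0 ≤ a) (hb : 0 ≤ b)
    (hab : a + b = 1) (hβh₁ : 0 ≤ βh₁) (hβh₂ : 0 ≤ βh₂) (h0₁ : βh₁ ≤ β₀) (h0₂ : βh₂ ≤ β₀) (hβ₀ : β₀ ≤ β) (hβ₀pos : 0 < β₀)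
    {L F₁ : ℝ → ℝ}
    (hC : ∀ s ∈ Icc s₁ s₂, ∀ U ∈ Icc U₂ U₃, energyDensityTT' t s U (a * n₁ + b * n₂) ≤ c₀ + c₁ * U)
    (hL : ∀ s ∈ Icc s₁ s₂, L s ≤ energyDensityTT' t s U₂ n₂)
    (hF₁ : ∀ s ∈ Icc s₁ s₂, ∀ U ∈ Icc U₂ U₃, F₁ s ≤ energyDensityTT' t s U n₁)
    (hπ₁ : ∀ s ∈ Icc s₁ s₂, ∀ U ∈ Icc U₂ U₃, pressureTT' βh₁ t s U n₁ ≤ π₁)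
    (hπ₂ : ∀ s ∈ Icc s₁ s₂, ∀ U ∈ Icc U₂ U₃, pressureTT' βh₂ t s U n₂ ≤ π₂)
    (hk : 4 / Real.pi * ∑ b, |tz b| ≤ k)
    (hm : ∀ s ∈ Icc s₁ s₂, 0 ≤ a * F₁ s + b * L s - (c₀ + c₁ * U₃) - k)
    (hg : ∀ s ∈ Icc s₁ s₂, a * π₁ + b * π₂ + βh₁ * (a * F₁ s) + βh₂ * (b * L s) <
      β₀ * (a * F₁ s + b * L s - (c₀ + c₁ * U₃) - k))
    {s : ℝ} (hs : s ∈ Icc s₁ s₂) {U : ℝ} (hU : U ∈ Icc U₂ U₃)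
    {ω₁ ω₂ : InfVolFermionState 3} (h₁ : ω₁.IsTranslationInvariant) (h₂ : ω₂.IsTranslationInvariant)
    (hρ₁ : 0 < ω₁.density) (hρ₁' : ω₁.density ≤ n₁) (hρ₂ : n₂ ≤ ω₂.density) (hρ₂' : ω₂.density < 2)
    {lam : ℝ} (hl0 : 0 < lam) (hl1 : lam < 1) :
    (mix lam hl0.le hl1.le ω₁ ω₂).entropyDensitySup -
        β * (mix lam hl0.le hl1.le ω₁ ω₂).meanEnergy (layeredHubbardTTPrime t s U w tz) R' <
      (layeredHubbardTTPrime t s U w tz).varPressureAt β R' (mix lam hl0.le hl1.le ω₁ ω₂).density := by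
  have hn2' : 0 ≤ n₂ := hn₁.trans hn.le
  have hβpos : 0 < β := hβ₀pos.trans_le hβ₀
  have hF₂ := floor_above_column_of_law t hn2' hn₂ hU₂ hL s hs U hU.1
  have k' := mul_le_mul_of_nonneg_left hU.2 hc₁
  have hM3 := hm s hs
  have hM : a * F₁ s + b * L s - (c₀ + c₁ * U₃) - k ≤ a * F₁ s + b * L s - (c₀ + c₁ * U) - k := by linarith
  have hMU : 0 ≤ a * F₁ s + b * L s - (c₀ + c₁ * U) - k := hM3.trans hM
  have k1 := mul_le_mul_of_nonneg_left hM hβ₀pos.le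
  have hg' := hg s hs
  have hM₀ : a * π₁ + b * π₂ + βh₁ * (a * F₁ s) + βh₂ * (b * L s) < β₀ * (a * F₁ s + b * L s - (c₀ + c₁ * U) - k) := by
    linarith
  exact h₁.sub_mul_layered_lt_varPressureAt_mix_of_hotAnchors_of_threshold_of_cost_le t s (hU₂.trans hU.1) hβpos hw tz hR' hwR'
    h₂ hρ₁ hρ₂' hρ₁' hn hρ₂ ha hb hab (hC s hs U hU) (hF₁ s hs U hU) hF₂ hβh₁ hβh₂ h0₁ h0₂ hβ₀ (hπ₁ s hs U hU) (hπ₂ s hs U hU)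
    hk hMU hM₀ hl0 hl1

end Summit.Ventures.CertifiedManyBodySolver.Observables
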